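/-
Copyright (c) 2026 the pub-hodgecm-mathlib formalisation cell (harness21).  Prover seat hodgecm-mathlib-LH4-p07 (g4), req620 Track A «(D-RAM) FOUR-FRAME» squad
(heir LEAD F0P3a-plan lineage; dealer LH4-plan lineage WORD #26 (1); MS ROAD A, Stage B₂ brick B7₂ (iii)₂ «CORE-HANGING STRATA, TYPE 2 — THE CLASS COUNT», FILE (b):
`polarisationCount` BY VALUE; Stage B lead LH4-p10 (g2); re-keyed on multiplicity by LH4-p11 (g2) 2026-09-04T00:53Z).  2026-09-04.
-/
import Summits.HodgeConjecture.HodgeConjecture.Theorems.F0P3cDyRamDiagonalCoreHangingPolarisationClassesTypeTwo   -- (ii)₂ (this seat): relatedness; brings (A) ★ p856406, (B), ★ p856076, ★ p856270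
import Summits.HodgeConjecture.HodgeConjecture.Theorems.F0P3cDyRamDiagonalFixedClassRefinementCount            -- (iii)₂ (a) (this seat): `ncard_reps_near_eq`
import Summits.HodgeConjecture.HodgeConjecture.Theorems.F0P3cDyRamDiagonalPolarisationCountTools               -- ★ LH4-p13 (g2): `polarisationCount_eq_card_of_reps`; brings ★ StrataDefs ED. 3 (`polarisationCount`)
import Summits.HodgeConjecture.HodgeConjecture.Theorems.F0P3cDyRamDiagonalPolarisationCoset                    -- ★ LH4-p11 (g2): `isVertexLattice_diagonal_mul_of_mem_fixedUnitStabilizer` (coset ⊆ Δ)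
import Summits.HodgeConjecture.HodgeConjecture.Theorems.F0P3cDyRamDiagonalGluedClassRepresentatives         -- ★ (iv-c) LH4-p08 (g2): `exists_fixed_class_representatives`
import HarnessLib

/-!
# Crux `H413`, MS ROAD A, STAGE B₂ brick B7₂ (iii)₂, FILE (b): «CORE-HANGING STRATA, TYPE 2 — `polarisationCount σ ϖ 2 (latt V) = q^{⌈(ρ+1)∕2⌉ − ⌈ρ∕2⌉}`»
# (`= q` for even `ρ`, `1` for odd `ρ`; the MULTIPLICITY of the re-keyed `stub_B7_H`)

Cell `hodgecm-mathlib` (D-0151), FLOOR 0, crux item H413 = `stmt-HodgeConjecture-24833`; lane `--supports stmt-HodgeConjecture-24833 --as helper` (count-neutral).  THEOREMS ONLY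
(no `def`, no instance, no notation, no `sorry`, default heartbeats).
THE VALUE (LH4-p11 (g2)'s re-key 2026-09-04T00:53Z of the type-2 half of (MS) on ★ StrataDefs ED. 3 `polarisationCount σ ϖ tv M = #(Δ_tv(M) ∕ S_F(M))`; LEAD (R-21)(c) amended; tables
LH4-r01 (g3) DV, REF5 R5-78 (C) ∕ R5-86 ∕ R5-90, LH4-p10 (g2) 01:03:42Z at q = 4: `n₂(H(3)) = 1`, `n₂(H(5)) = 4`, …): on the core-hanging type-2 frame
`V = (1 0 0; x ϖ^ρ 0; xζ+y″ ϖ^ρζ ϖ^{2ρ+1})` (`x, ζ, y″, xζ+y″` units, `ρ ≥ 1`) that IS polarisable ((R) holds for some fixed `f₀`),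
  **`polarisationCount σ ϖ 2 (latt V) = q^{(ρ+2)∕2 − (ρ+1)∕2}`.**
ASSEMBLY (★ p13 `polarisationCount_eq_card_of_reps`): `reps` := the explicit polarisations `D(g) = (P·g° − Nx·D₁(g) − Ny·P, D₁(g) := −P(Nζ+g), P)`, `P = π₀^{−ρ}`, `g° = −B_gσB_g∕g`
((B) `isVertexLattice_two_latt_coreHanging_of_letters`) for `g` in `R₀ := {g ∈ R : |g − f₀| ≤ |ϖ|^ρ}`, `R` a complete irredundant system of `σ`-fixed units modulo `𝔭^{ρ+1}`
(★ `exists_fixed_class_representatives`); `hΔ` — every polarisation `D` is `S_F`-related to `D(g)` for the representative `g` of its letter `f_D` modulo `𝔭^{ρ+1}` ((ii)₂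
`exists_mem_fixedUnitStabilizer_iff_v_sub_le`, since `D(g)₁∕D(g)₂ − D₁∕D₂ = f_D − g`), and conversely `D(g)·S_F ⊆ Δ₂` (★ `isVertexLattice_diagonal_mul_of_mem_fixedUnitStabilizer`);
`hfree` — distinct representatives are unrelated ((ii)₂ ⟹ and irredundance); `#reps = #R₀ = q^{(ρ+2)∕2 − (ρ+1)∕2}` ((iii)₂ (a) `ncard_reps_near_eq`).
* §1 `explicit_polarisation` — `D(g)` is a fixed non-degenerate type-2 polarisation for every fixed `g` with (R) ((B) with (COF) `= 0`).
* §2 HEAD **`polarisationCount_two_latt_coreHanging_eq`**, and `…_of_isTypeTwoPolarisable` (the hypothesis as ★ `IsTypeTwoPolarisable`, via (B)'s criterion).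
HONEST LABEL.  Count-neutral; the census laws stay PROVER TARGETS until the MS assembly lands; `HC_CM` is proved only modulo the 7 printed citations (2 remaining named inputs:
hLiu418 = `stmt-HodgeConjecture-24832`, h413 = `stmt-HodgeConjecture-24833`) until rung 0 closes.

## References
* [Kottwitz1986BaseChangeUnits] R. Kottwitz, *Base change for unit elements of Hecke algebras*, Compositio Math. 60 (1986), §1 pp. 240–241 (counting modulo the torus).
* [Jacobowitz1962] R. Jacobowitz, *Hermitian forms over local fields*, Amer. J. Math. 84 (1962), §7 (modular lattices and their Gram matrices).
* [Serre1979] J.-P. Serre, *Local Fields*, GTM 67, Springer (1979), Ch. IV §2 Prop. 6 (the filtration `U^{(n)}`).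
-/

set_option autoImplicit false

noncomputable section

namespace Summit.HodgeConjecture.HodgeConjecture.Cruxes.H413.F0P3cDyRamDiagonalCoreHangingPolarisationCountTypeTwo

open Matrix
open Literature.NumberTheory.Automorphic Literature.NumberTheory.Automorphic.HermitianLattice Literature.NumberTheory.Automorphic.UnitaryGroup
open Literature.NumberTheory.Automorphic.UnitaryLatticeTree
open Summit.HodgeConjecture.HodgeConjecture.Cruxes.H413.F0P3cDyRamDiagonalTorusDefs
open Summit.HodgeConjecture.HodgeConjecture.Cruxes.H413.F0P3cDyRamDiagonalStrataDefs
open Summit.HodgeConjecture.HodgeConjecture.Cruxes.H413.F0P3cDyRamDiagonalGluedStabiliserIndex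
open Summit.HodgeConjecture.HodgeConjecture.Cruxes.H413.F0P3cDyRamDiagonalGluedClassRepresentatives
open Summit.HodgeConjecture.HodgeConjecture.Cruxes.H413.F0P3cDyRamDiagonalPolarisationCoset
open Summit.HodgeConjecture.HodgeConjecture.Cruxes.H413.F0P3cDyRamDiagonalPolarisationCountTools
open Summit.HodgeConjecture.HodgeConjecture.Cruxes.H413.F0P3cDyRamDiagonalCoreHangingCriterionTypeTwo
open Summit.HodgeConjecture.HodgeConjecture.Cruxes.H413.F0P3cDyRamDiagonalCoreHangingPolarisationClassesTypeTwo
open Summit.HodgeConjecture.HodgeConjecture.Cruxes.H413.F0P3cDyRamDiagonalFixedClassRefinementCount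
open scoped Valued WithZero Matrix MatrixGroups

variable {K : Type*} [Field K] [Valued K ℤᵐ⁰]

/-! ## §1  The explicit polarisation attached to a fixed `g` with (R) -/

/-- **THE EXPLICIT TYPE-2 POLARISATION `D(g)`** of the core-hanging frame for a `σ`-fixed `g` with (R) `|ζσy″ − σx·g| ≤ |ϖ|^ρ`: `D(g) = (P·g° − Nx·D₁ − Ny·P, D₁ := −P(Nζ+g), P)`,
`P = π₀^{−ρ}`, `g° = −B_gσB_g∕g` — (B) `isVertexLattice_two_latt_coreHanging_of_letters` at (COF) `= 0`; fixed, non-degenerate, and `D(g)₁∕D(g)₂ = −(Nζ + g)`.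
[cite: Jacobowitz1962, §7] [cite: Kottwitz1986BaseChangeUnits, §1 pp. 240–241] -/
theorem explicit_polarisation {σ : K →+* K} (hσ : ∀ a, σ (σ a) = a) (hvσ : ∀ a, Valued.v (σ a) = Valued.v a)
    {ϖ : K} (hϖ0 : ϖ ≠ 0) (hϖ1 : Valued.v ϖ < 1) (hTr : ∀ a : K, Valued.v (a + σ a) ≤ Valued.v ϖ * Valued.v a)
    (ρ : ℕ) (hρ : 1 ≤ ρ) {x ζ y'' : K} (hx : Valued.v x = 1) (hζ : Valued.v ζ = 1) (hy'' : Valued.v y'' = 1) (hy : Valued.v (x * ζ + y'') = 1)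
    (V : GL (Fin 3) K) (hV : (V : Matrix (Fin 3) (Fin 3) K) = !![1, 0, 0; x, ϖ ^ ρ, 0; x * ζ + y'', ϖ ^ ρ * ζ, ϖ ^ (2 * ρ + 1)])
    {g : K} (hg : σ g = g) (hRg : Valued.v (ζ * σ y'' - σ x * g) ≤ Valued.v ϖ ^ ρ)
    {P gg D₁ D₀ : K} (hP : P = ((ϖ * σ ϖ) ^ ρ)⁻¹) (hgg : gg = -((ζ * σ y'' - σ x * g) * (σ ζ * y'' - x * g)) / g)
    (hD₁ : D₁ = -(P * (ζ * σ ζ + g))) (hD₀ : D₀ = P * gg - (σ x * D₁ * x + σ (x * ζ + y'') * P * (x * ζ + y''))) :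
    (∀ i, σ ((![D₀, D₁, P] : Fin 3 → K) i) = (![D₀, D₁, P] : Fin 3 → K) i ∧ (![D₀, D₁, P] : Fin 3 → K) i ≠ 0) ∧
      IsVertexLattice σ ϖ (Matrix.diagonal ![D₀, D₁, P]) 2 (latt (V : Matrix (Fin 3) (Fin 3) K)) := by
  have hvϖ : 0 < Valued.v ϖ := (Valuation.pos_iff _).2 hϖ0
  -- `|g| = 1`, so `g ≠ 0`
  have h1 : Valued.v (ζ * σ y'') = 1 := by rw [map_mul, hζ, hvσ, hy'', one_mul]
  have hBlt : Valued.v (ζ * σ y'' - σ x * g) < 1 := hRg.trans_lt (pow_lt_one₀ zero_le hϖ1 (by omega))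
  have hvxg : Valued.v (σ x * g) = 1 := by
    have e : σ x * g = ζ * σ y'' + -(ζ * σ y'' - σ x * g) := by ring
    rw [e, Valuation.map_add_eq_of_lt_left _ (by rwa [Valuation.map_neg, h1]), h1]
  have hvg : Valued.v g = 1 := by rw [map_mul, hvσ, hx, one_mul] at hvxg; exact hvxg
  have hg0 : g ≠ 0 := fun h => by rw [h, map_zero] at hvg; exact zero_ne_one hvg
  -- the letters
  have hσP : σ P = P := by rw [hP, map_inv₀, map_pow, map_mul, hσ, mul_comm]
  have hvP : Valued.v P = (Valued.v ϖ ^ (2 * ρ))⁻¹ := by rw [hP, map_inv₀, map_pow, map_mul, hvσ, ← sq, ← pow_mul]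
  have hσgg : σ gg = gg := by
    rw [hgg, map_div₀, map_neg, map_mul, map_sub, map_sub, map_mul, map_mul, map_mul, map_mul, hσ, hσ, hσ, hg]; ring
  have hcof : Valued.v (g * gg + (ζ * σ y'' - σ x * g) * (σ ζ * y'' - x * g)) ≤ Valued.v ϖ ^ (2 * ρ + 1) := by
    have e : g * gg + (ζ * σ y'' - σ x * g) * (σ ζ * y'' - x * g) = 0 := by rw [hgg]; field_simp; ring
    rw [e, map_zero]; exact zero_le
  obtain ⟨hDfix, -, hvert⟩ := isVertexLattice_two_latt_coreHanging_of_letters hσ hvσ hϖ0 hϖ1 hTr ρ hρ hx hζ hy'' hy V hV hσP hvP hg hRg hσgg hcof hD₁ hD₀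
  exact ⟨hDfix, hvert⟩

/-! ## §2  HEAD — the count -/

/-- **B7₂ (iii)₂ — `polarisationCount σ ϖ 2 (latt V) = q^{(ρ+2)∕2 − (ρ+1)∕2}` ON THE CORE-HANGING TYPE-2 FRAME** (`= q` for even `ρ`, `1` for odd `ρ`).  Ramified quadratic datum
letters `hσ hvσ hfix hϖ hd`, the wild trace bound `hTr`, a finite residue field (`q = #𝓀`), `ρ ≥ 1`, units `x, ζ, y″, xζ+y″`, `V = (1 0 0; x ϖ^ρ 0; xζ+y″ ϖ^ρζ ϖ^{2ρ+1})`, and a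
fixed `f₀` with (R) `|ζσy″ − σx·f₀| ≤ |ϖ|^ρ` (i.e. `latt V` IS type-2 polarisable, (B)).  Assembly of (B) (explicit forms), (ii)₂ (relatedness ⟺ `|f − f′| ≤ |ϖ|^{ρ+1}`), (iii)₂ (a)
(class refinement count) into ★ p13 `polarisationCount_eq_card_of_reps`. [cite: Kottwitz1986BaseChangeUnits, §1 pp. 240–241] [cite: Serre1979, Ch. IV §2 Prop. 6] -/
theorem polarisationCount_two_latt_coreHanging_eq {σ : K →+* K} {ϖ : K} {d : ℕ} (hσ : ∀ a, σ (σ a) = a) (hvσ : ∀ a, Valued.v (σ a) = Valued.v a)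
    (hfix : ∀ x : K, σ x = x → x ≠ 0 → ∃ n : ℤ, Valued.v x = WithZero.exp (2 * n)) (hϖ : Valued.v ϖ = WithZero.exp (-1 : ℤ))
    (hd : Valued.v (ϖ - σ ϖ) = Valued.v ϖ ^ d) (hTr : ∀ a : K, Valued.v (a + σ a) ≤ Valued.v ϖ * Valued.v a) [Finite 𝓀[K]]
    (ρ : ℕ) (hρ : 1 ≤ ρ) {x ζ y'' : K} (hx : Valued.v x = 1) (hζ : Valued.v ζ = 1) (hy'' : Valued.v y'' = 1) (hy : Valued.v (x * ζ + y'') = 1)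
    (V : GL (Fin 3) K) (hV : (V : Matrix (Fin 3) (Fin 3) K) = !![1, 0, 0; x, ϖ ^ ρ, 0; x * ζ + y'', ϖ ^ ρ * ζ, ϖ ^ (2 * ρ + 1)])
    {f₀ : K} (hf₀ : σ f₀ = f₀) (hR₀ : Valued.v (ζ * σ y'' - σ x * f₀) ≤ Valued.v ϖ ^ ρ) :
    polarisationCount σ ϖ 2 (latt (V : Matrix (Fin 3) (Fin 3) K)) = Nat.card 𝓀[K] ^ ((ρ + 2) / 2 - (ρ + 1) / 2) := by
  classical
  obtain ⟨hϖ0, hϖ1⟩ := ne_zero_and_v_lt_one_of_v_eq_exp hϖ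
  have hvϖ : 0 < Valued.v ϖ := (Valuation.pos_iff _).2 hϖ0
  have hϖρ1 : Valued.v ϖ ^ ρ < 1 := pow_lt_one₀ zero_le hϖ1 (by omega)
  have hϖle : Valued.v ϖ ^ (ρ + 1) ≤ Valued.v ϖ ^ ρ := pow_le_pow_right_of_le_one' hϖ1.le (by omega)
  set y : K := x * ζ + y'' with hydef
  set Nζ : K := ζ * σ ζ with hNζ
  -- `|φ| = 1` for every `φ` with (R); `|f₀| = 1`
  have h1 : Valued.v (ζ * σ y'') = 1 := by rw [map_mul, hζ, hvσ, hy'', one_mul]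
  have hunit : ∀ {φ : K}, Valued.v (ζ * σ y'' - σ x * φ) ≤ Valued.v ϖ ^ ρ → Valued.v φ = 1 := fun {φ} hφ => by
    have hvxf : Valued.v (σ x * φ) = 1 := by
      have e : σ x * φ = ζ * σ y'' + -(ζ * σ y'' - σ x * φ) := by ring
      rw [e, Valuation.map_add_eq_of_lt_left _ (by rw [Valuation.map_neg, h1]; exact hφ.trans_lt hϖρ1), h1]
    rw [map_mul, hvσ, hx, one_mul] at hvxf; exact hvxf
  have hvf₀ : Valued.v f₀ = 1 := hunit hR₀
  -- (R) transfers along `|φ − f₀| ≤ |ϖ|^ρ`, and conversely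
  have hRdiff : ∀ φ : K, ζ * σ y'' - σ x * φ = (ζ * σ y'' - σ x * f₀) + σ x * (f₀ - φ) := fun φ => by ring
  have hR_of_near : ∀ {φ : K}, Valued.v (φ - f₀) ≤ Valued.v ϖ ^ ρ → Valued.v (ζ * σ y'' - σ x * φ) ≤ Valued.v ϖ ^ ρ := fun {φ} hφ => by
    rw [hRdiff φ]
    refine (Valuation.map_add _ _ _).trans (max_le hR₀ ?_)
    rw [map_mul, hvσ, hx, one_mul, Valuation.map_sub_swap]; exact hφ
  have hnear_of_R : ∀ {φ : K}, Valued.v (ζ * σ y'' - σ x * φ) ≤ Valued.v ϖ ^ ρ → Valued.v (φ - f₀) ≤ Valued.v ϖ ^ ρ := fun {φ} hφ => by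
    have e : φ - f₀ = (σ x)⁻¹ * ((ζ * σ y'' - σ x * f₀) - (ζ * σ y'' - σ x * φ)) := by
      have hσx0 : σ x ≠ 0 := fun h0 => by have := hvσ x; rw [h0, map_zero, hx] at this; exact zero_ne_one this
      field_simp; ring
    rw [e, map_mul, map_inv₀, hvσ, hx, inv_one, one_mul]
    exact v_sub_le_of_le hR₀ hφ
  -- representatives of the fixed units modulo `𝔭^{ρ+1}`, and those in the (R)-class
  obtain ⟨R, hRfin, -, hR1, hR2, hR3⟩ := exists_fixed_class_representatives hσ hvσ hfix hϖ hd (ρ + 1) 0 (by omega)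
  simp only [Nat.mul_zero, pow_zero, Nat.add_zero] at hR1 hR2 hR3
  set R₀ : Set K := {g ∈ R | Valued.v (g - f₀) ≤ Valued.v ϖ ^ ρ} with hR₀
  have hR₀fin : R₀.Finite := hRfin.subset (Set.sep_subset _ _)
  have hcount : R₀.ncard = Nat.card 𝓀[K] ^ ((ρ + 2) / 2 - (ρ + 1) / 2) := ncard_reps_near_eq hσ hvσ hfix hϖ hd hρ hRfin hR1 hR2 hR3 hf₀ hvf₀
  -- the explicit forms
  set P : K := ((ϖ * σ ϖ) ^ ρ)⁻¹ with hP
  have hP0 : P ≠ 0 := by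
    rw [hP]; refine inv_ne_zero (pow_ne_zero _ (mul_ne_zero hϖ0 fun h => hϖ0 ?_)); rw [← hσ ϖ, h, map_zero]
  let Dm : K → Fin 3 → K := fun g =>
    ![P * (-((ζ * σ y'' - σ x * g) * (σ ζ * y'' - x * g)) / g) - (σ x * (-(P * (Nζ + g))) * x + σ y * P * y), -(P * (Nζ + g)), P]
  have hDm1 : ∀ g, Dm g 1 = -(P * (Nζ + g)) := fun _ => rfl
  have hDm2 : ∀ g, Dm g 2 = P := fun _ => rfl
  have hratioDm : ∀ g, Dm g 1 / Dm g 2 = -(Nζ + g) := fun g => by rw [hDm1, hDm2]; field_simp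
  have hform : ∀ g : K, σ g = g → Valued.v (ζ * σ y'' - σ x * g) ≤ Valued.v ϖ ^ ρ →
      (∀ i, σ (Dm g i) = Dm g i ∧ Dm g i ≠ 0) ∧ IsVertexLattice σ ϖ (Matrix.diagonal (Dm g)) 2 (latt (V : Matrix (Fin 3) (Fin 3) K)) :=
    fun g hg hRg => explicit_polarisation hσ hvσ hϖ0 hϖ1 hTr ρ hρ hx hζ hy'' hy V hV hg hRg hP rfl rfl rfl
  -- the letter `f_D` of a polarisation and its ratio
  have hletter : ∀ {D : Fin 3 → K}, (∀ i, σ (D i) = D i ∧ D i ≠ 0) → IsVertexLattice σ ϖ (Matrix.diagonal D) 2 (latt (V : Matrix (Fin 3) (Fin 3) K)) →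
      σ (-(D 1 + D 2 * Nζ) / D 2) = -(D 1 + D 2 * Nζ) / D 2 ∧ Valued.v (ζ * σ y'' - σ x * (-(D 1 + D 2 * Nζ) / D 2)) ≤ Valued.v ϖ ^ ρ ∧
        D 1 / D 2 = -(Nζ + -(D 1 + D 2 * Nζ) / D 2) := fun {D} hD hvert => by
    obtain ⟨hσf, -, -, hR, -⟩ := letters_and_v_of_mem_Delta2 hσ hvσ hfix hϖ hTr ρ hρ hx hζ hy'' hy V hV hD hvert rfl rfl
    refine ⟨hσf, hR, ?_⟩
    have hD2 : D 2 ≠ 0 := (hD 2).2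
    field_simp; ring
  -- the representative set
  let reps : Finset (Fin 3 → K) := hR₀fin.toFinset.image Dm
  have hmem_reps : ∀ {D₁ : Fin 3 → K}, D₁ ∈ reps ↔ ∃ g ∈ R₀, Dm g = D₁ := fun {D₁} => by
    simp only [reps, Finset.mem_image, Set.Finite.mem_toFinset]
  have hinj : Set.InjOn Dm R₀ := fun g _ g' _ h => by
    have h1 := congrFun h 1
    rw [hDm1, hDm1, neg_inj] at h1
    exact add_left_cancel (mul_left_cancel₀ hP0 h1)
  have hcard : reps.card = Nat.card 𝓀[K] ^ ((ρ + 2) / 2 - (ρ + 1) / 2) := by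
    rw [Finset.card_image_of_injOn (by simpa only [Set.Finite.coe_toFinset] using hinj), ← Set.ncard_eq_toFinset_card R₀ hR₀fin, hcount]
  rw [← hcard]
  refine polarisationCount_eq_card_of_reps reps (fun D₁ hD₁ => ?_) (fun D hD => ⟨fun hvert => ?_, ?_⟩) (fun D₁ hD₁ D₂ hD₂ u hu hDu => ?_)
  · -- `hrepsfix`
    obtain ⟨g, hg, rfl⟩ := hmem_reps.1 hD₁
    exact (hform g (hR1 g hg.1).1 (hR_of_near hg.2)).1
  · -- `hΔ` ⟹ : relate `D` to the form of the representative of its letter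
    obtain ⟨hσf, hRf, hratio⟩ := hletter hD hvert
    set f : K := -(D 1 + D 2 * Nζ) / D 2 with hf
    have hvf : Valued.v f = 1 := hunit hRf
    obtain ⟨g, hgR, hfg⟩ := hR2 f hσf hvf
    have hg₀ : g ∈ R₀ := by
      refine ⟨hgR, ?_⟩
      have e : g - f₀ = (f - f₀) + -(f - g) := by ring
      rw [e]
      exact (Valuation.map_add _ _ _).trans (max_le (hnear_of_R hRf) (by rw [Valuation.map_neg]; exact hfg.trans hϖle))
    obtain ⟨hDg, hvertg⟩ := hform g (hR1 g hgR).1 (hR_of_near hg₀.2)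
    have hrel : Valued.v (Dm g 1 / Dm g 2 - D 1 / D 2) ≤ Valued.v ϖ ^ (ρ + 1) := by
      rw [hratioDm, hratio, show -(Nζ + g) - -(Nζ + f) = f - g by ring]; exact hfg
    obtain ⟨u, hu, hDu⟩ := (exists_mem_fixedUnitStabilizer_iff_v_sub_le hσ hvσ hfix hϖ hTr ρ hρ hx hζ hy'' hy V hV hDg hvertg hD hvert).2 hrel
    exact ⟨Dm g, hmem_reps.2 ⟨g, hg₀, rfl⟩, u, hu, hDu⟩
  · -- `hΔ` ⟸ : cosets of polarisations are polarisations
    rintro ⟨D₁, hD₁, u, hu, hDu⟩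
    obtain ⟨g, hg, rfl⟩ := hmem_reps.1 hD₁
    have hfun : (fun i => Dm g i * (u i : K)) = D := funext fun i => (hDu i).symm
    exact hfun ▸ isVertexLattice_diagonal_mul_of_mem_fixedUnitStabilizer σ (hform g (hR1 g hg.1).1 (hR_of_near hg.2)).2 hu
  · -- `hfree` : related representatives are equal
    obtain ⟨g, hg, rfl⟩ := hmem_reps.1 hD₁
    obtain ⟨g', hg', rfl⟩ := hmem_reps.1 hD₂
    obtain ⟨hDg, hvertg⟩ := hform g (hR1 g hg.1).1 (hR_of_near hg.2)
    obtain ⟨hDg', hvertg'⟩ := hform g' (hR1 g' hg'.1).1 (hR_of_near hg'.2)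
    have hrel := (exists_mem_fixedUnitStabilizer_iff_v_sub_le hσ hvσ hfix hϖ hTr ρ hρ hx hζ hy'' hy V hV hDg hvertg hDg' hvertg').1 ⟨u, hu, hDu⟩
    rw [hratioDm, hratioDm, show -(Nζ + g) - -(Nζ + g') = g' - g by ring] at hrel
    rw [hR3 g' hg'.1 g hg.1 hrel]

/-- **THE SAME WITH THE HYPOTHESIS AS ★ `IsTypeTwoPolarisable`** ((B) `isTypeTwoPolarisable_latt_hnf_coreHanging_iff` supplies the fixed `f₀` with (R)): on a polarisable
core-hanging type-2 frame lattice, `polarisationCount σ ϖ 2 (latt V) = q^{(ρ+2)∕2 − (ρ+1)∕2}`. [cite: Kottwitz1986BaseChangeUnits, §1 pp. 240–241] [cite: Serre1979, Ch. IV §2 Prop. 6] -/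
theorem polarisationCount_two_latt_coreHanging_eq_of_isTypeTwoPolarisable {σ : K →+* K} {ϖ : K} {d : ℕ} (hσ : ∀ a, σ (σ a) = a)
    (hvσ : ∀ a, Valued.v (σ a) = Valued.v a) (hfix : ∀ x : K, σ x = x → x ≠ 0 → ∃ n : ℤ, Valued.v x = WithZero.exp (2 * n))
    (hϖ : Valued.v ϖ = WithZero.exp (-1 : ℤ)) (hd : Valued.v (ϖ - σ ϖ) = Valued.v ϖ ^ d) (hTr : ∀ a : K, Valued.v (a + σ a) ≤ Valued.v ϖ * Valued.v a) [Finite 𝓀[K]]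
    (ρ : ℕ) (hρ : 1 ≤ ρ) {x ζ y'' : K} (hx : Valued.v x = 1) (hζ : Valued.v ζ = 1) (hy'' : Valued.v y'' = 1) (hy : Valued.v (x * ζ + y'') = 1)
    (V : GL (Fin 3) K) (hV : (V : Matrix (Fin 3) (Fin 3) K) = !![1, 0, 0; x, ϖ ^ ρ, 0; x * ζ + y'', ϖ ^ ρ * ζ, ϖ ^ (2 * ρ + 1)])
    (hpol : IsTypeTwoPolarisable σ ϖ (latt (V : Matrix (Fin 3) (Fin 3) K))) :
    polarisationCount σ ϖ 2 (latt (V : Matrix (Fin 3) (Fin 3) K)) = Nat.card 𝓀[K] ^ ((ρ + 2) / 2 - (ρ + 1) / 2) := by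
  obtain ⟨hϖ0, hϖ1⟩ := ne_zero_and_v_lt_one_of_v_eq_exp hϖ
  obtain ⟨f₀, hf₀, hR₀⟩ := (isTypeTwoPolarisable_latt_hnf_coreHanging_iff hσ hvσ hϖ0 hϖ1 hTr ρ hρ hx hζ hy'' hy V hV).1 hpol
  exact polarisationCount_two_latt_coreHanging_eq hσ hvσ hfix hϖ hd hTr ρ hρ hx hζ hy'' hy V hV hf₀ hR₀

end Summit.HodgeConjecture.HodgeConjecture.Cruxes.H413.F0P3cDyRamDiagonalCoreHangingPolarisationCountTypeTwo

end
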